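import Summits.Ventures.PackingBounds.Configurations.LeechEnergyRigidity
import Summits.Ventures.PackingBounds.Configurations.E8GroundState

/-!
# Riesz ground states of `196560` points on `S²³` are optimal kissing configurations

Framing: lottery ticket; floor = certified bounds/negative ranges. Venture `PackingBounds` (cell
`pub-packcert`, seat `pub-packcert-energy`).

Corollary of `LeechEnergyRigidity.kissing_of_energy_eq` via Bernstein's theorem
(`AbsolutelyMonotonePowerSeries.hasSum_taylor`) and the positivity of the derivatives of the inverse power
laws at `-1` (`E8GroundState.iteratedDerivWithin_rpow_chordal_pos`): **for every `s > 0`, every minimiser of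
the Riesz `s`-energy among `196560`-point configurations on `S²³` is an optimal kissing configuration
(pairwise inner products `≤ 1/2`, so `κ(24) = 196560` is attained) and has the Leech energy for EVERY pair
potential** (`kissing_of_riesz_ground_state`; the tree's `Config.Leech.energy_eq_of_card_eq_196560`
supplies the second part). The last step of Cohn–Kumar's uniqueness — such a configuration is isometric to
the Leech minimal vectors (Bannai–Sloane Thm. 22) — is not in the tree.

## References
* H. Cohn, A. Kumar, J. Amer. Math. Soc. 20 (2007) 99–148, Theorem 1.2. [`CohnKumar2006`]
-/

noncomputable section

namespace Summit.Ventures.PackingBounds.Config.LeechGroundState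

open Finset Set Literature.Analysis.Calculus Summit.Ventures.PackingBounds.Energy
open scoped ContDiff

section config

variable {C : Finset (EuclideanSpace ℝ (Fin 24))} (h1 : ∀ x ∈ C, ‖x‖ = 1) (hN : C.card = 196560)
include h1 hN

/-- **Every Riesz ground state of `196560` points on `S²³` is an optimal kissing configuration with the
Leech energies.** For `p > 0`, if `C` (196560 unit vectors of `ℝ²⁴`) has the minimal value
`196560 (4^{-p} + 4600·3^{-p} + 47104·(5/2)^{-p} + 93150·2^{-p} + 47104·(3/2)^{-p} + 4600)` of
`Σ_{x≠y} (2 - 2⟨x,y⟩)^{-p}` (`Energy.riesz_energy_ge_Leech`), then all pairwise inner products are `≤ 1/2`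
and, for EVERY pair potential `b`, `Σ_{x≠y} b(⟨x,y⟩)` equals the Leech value. [cite: CohnKumar2006, Theorem 1.2] -/
theorem kissing_of_riesz_ground_state (p : ℝ) (hp : 0 < p)
    (hE : ∑ x ∈ C, ∑ y ∈ C.erase x, (2 - 2 * inner ℝ x y) ^ (-p) =
      (196560 : ℝ) * ((4 : ℝ) ^ (-p) + 4600 * (3 : ℝ) ^ (-p) + 47104 * (5 / 2 : ℝ) ^ (-p)
        + 93150 * (2 : ℝ) ^ (-p) + 47104 * (3 / 2 : ℝ) ^ (-p) + 4600)) :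
    (∀ x ∈ C, ∀ y ∈ C, x ≠ y → inner ℝ x y ≤ 1 / 2) ∧
      ∀ b : ℝ → ℝ, ∑ x ∈ C, ∑ y ∈ C.erase x, b (inner ℝ x y) =
        196560 * (b (-1) + 4600 * b (-1 / 2) + 47104 * b (-1 / 4) + 93150 * b 0 + 47104 * b (1 / 4)
          + 4600 * b (1 / 2)) := by
  set a : ℝ → ℝ := fun t => (2 - 2 * t) ^ (-p) with hadef
  have ha : AbsolutelyMonotoneOn a (Ico (-1) 1) :=
    Energy.RieszAbsolutelyMonotone.absolutelyMonotoneOn_rpow_chordal p hp.le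
  set c : ℕ → ℝ := fun k => iteratedDerivWithin k a (Ico (-1) 1) (-1) / (Nat.factorial k) with hc
  have hc0 : ∀ k, 0 ≤ c k := fun k =>
    div_nonneg (ha.iteratedDerivWithin_nonneg (uniqueDiffOn_Ico (-1) 1) k ⟨le_rfl, by norm_num⟩)
      (Nat.cast_nonneg _)
  have hsum : ∀ s : ℝ, -1 ≤ s → s < 1 → HasSum (fun k => c k * (1 + s) ^ k) (a s) := by
    intro s hs1 hs2
    have h := AbsolutelyMonotonePowerSeries.hasSum_taylor ha (x := s) ⟨hs1, hs2⟩
    simpa only [hc, sub_neg_eq_add, add_comm s 1] using h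
  have hc12 : 0 < c 12 := div_pos (E8GroundState.iteratedDerivWithin_rpow_chordal_pos p hp 12) (by positivity)
  have hE' : ∑ x ∈ C, ∑ y ∈ C.erase x, a (inner ℝ x y) =
      (196560 : ℝ) * (a (-1) + 4600 * a (-1 / 2) + 47104 * a (-1 / 4)
        + 93150 * a 0 + 47104 * a (1 / 4) + 4600 * a (1 / 2)) := by
    simp only [hadef]
    rw [hE]
    norm_num
  have hkiss := LeechEnergyRigidity.kissing_of_energy_eq h1 hN a c hc0 hsum 12 le_rfl hc12 hE'
  exact ⟨hkiss, fun b => Leech.energy_eq_of_card_eq_196560 h1 hkiss hN b⟩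

end config

end Summit.Ventures.PackingBounds.Config.LeechGroundState

end
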